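import Mathlib
import Summits.ValiantsHypothesis.ValiantsHypothesis.Theorems.FreeSubtorusSubtorusCovering

/-!
# `OrbitDimensionBound` (stmt-ValiantsHypothesis-16133), rung line `affine_gauge` — stub `stub_gaugeReduction`

The line `Cruxes/OrbitDimensionBound/Lines/affine_gauge.lean` (route `FreeSubtorus`, rung `Gauge.AffineGaugeShadow`) has
three stubs: `stub_nilpotentGauge` (LANDED, p601028), the core `stub_untwist` (OPEN) and the reduction proved here,

  `stub_gaugeReduction : GaugeTorusBound 1 → AffineGaugeCovering`

(statement = the line's, with `GaugeTorusBound`, `AffineGaugeCovering = GaugeCovering 1`, `GaugeLifts`, `subtorusGen`,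
`fullTorusGen` of `Lines/GaugeLadder.lean` UNFOLDED; no definitions here): IF every affine determinantal representation of
`per_n` (`n ≥ 3`) with DEGREE-`1` unimodular gauge lifts of the full two-sided torus has size `≥ 2^n − 1` (the engine at
gauge degree `1`, a hypothesis), THEN every affine representation of size `m` with degree-`1` lifts of an admissibly cut
subtorus `T_Λ` (`r` generators) has `C(n, ⌊n/2⌋) ≤ m · 2^r`.

**Proof** = the floor's pair sacrifice (`Theorems/FreeSubtorusSubtorusCovering.lean :: subtorusCovering_proof`, route item
16134) run one gauge degree up, its stubs used BY NAME: `stub_indepMatching` (a maximal `ℚ`-independent partial matching,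
`s ≤ r`), the degenerate branch `n ≤ s + 2` (degree bound `n ≤ m`), relabelling to the last `s` diagonal positions
(`exists_perm_extend_embedding`; degree-`1` lifts survive renaming: `gaugeLifts_one_relabel`, via the floor's
`linSubstEntries_map_rename_diagonal` and `rename_prodMap_perPoly`), `stub_torusExtension` (extension of `N`-th powers
of the free torus inside `T_{Λ'}`), the substitution `x_{(n'+j, n'+j)} = 1`, `0` elsewhere on the sacrificed rows/columns
(`stub_substPer`: `det ↦ per_{n'}`), and the ONE changed step: degree-`1` lifts DESCEND through the substitution
(`gaugeLifts_one_subst`: the floor's intertwining `aeval g ∘ (γ·) = (γ'·) ∘ aeval g`, and `aeval g` is a ring map preserving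
total degree `≤ 1` — `totalDegree_aeval_le_one` — and unit determinants); then the HYPOTHESIS gives `2^{n'} − 1 ≤ m` and
`C(n, ⌊n/2⌋) ≤ 2^{n−1} ≤ (2^{n'} − 1)·2^s ≤ m·2^r` (`choose_middle_le_two_pow_pred`).

Helper mode (`--supports stmt-ValiantsHypothesis-16133 --as helper`): the item's registered skeleton is `affine_multiple`;
no stub credit moves.  Honest framing: a reduction between two OPEN statements of a rung line (the engine
`GaugeTorusBound 1` is NOT proved here; the core `stub_untwist` is open); the crux `OrbitDimensionBound`, the route
`FreeSubtorus` and VP ≠ VNP are OPEN and NOT moved by this file.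

## References
* [LandsbergRessayre2017] J. M. Landsberg, N. Ressayre, *Permanent v. determinant: an exponential lower bound assuming
  symmetry and a potential path towards Valiant's conjecture*, Differential Geom. Appl. 55 (2017), Thm. 2.8, §6.
-/

open Matrix MvPolynomial Finset
open Literature.Computability.AlgebraicComplexity
open Summit.ValiantsHypothesis.ValiantsHypothesis.Theorems.FreeSubtorusSubtorusCovering

-- the mandated summit-side namespace repeats a component by design (single-problem summit)
set_option linter.dupNamespace false

namespace Summit.ValiantsHypothesis.ValiantsHypothesis.Theorems.FreeSubtorusOrbitDimensionBound.AffineGauge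

noncomputable section

/-! ### §1 Degree-one lifts survive relabelling of rows and columns -/

/-- Relabelling rows by `ρ` and columns by `κ` transports degree-`1` unimodular lifts of the generators of `T_Λ` to
degree-`1` unimodular lifts of the generators of `T_{Λ'}`, `Λ' = Λ ∘ (ρ⁻¹ ⊔ κ⁻¹)` (the floor's `stub_relabel`, one gauge
degree up). [folklore] -/
theorem gaugeLifts_one_relabel (n r m : ℕ) (Λ : Fin r → (Fin n ⊕ Fin n) → ℤ)
    (B : Matrix (Fin m) (Fin m) (MvPolynomial (Fin n × Fin n) ℂ)) (ρ κ : Equiv.Perm (Fin n))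
    (hB : IsAffineDetRepr (perPoly (Fin n) ℂ) B)
    (hL : ∀ γ ∈ {γ : Matrix.GeneralLinearGroup (Fin n × Fin n) ℂ |
        ∃ d e : Fin n → ℂˣ,
          (∀ i, (∏ k, (d k) ^ (Λ i (Sum.inl k))) * (∏ l, (e l) ^ (Λ i (Sum.inr l))) = 1) ∧
          (γ : Matrix (Fin n × Fin n) (Fin n × Fin n) ℂ) =
            Matrix.diagonal (fun p => (d p.1 : ℂ) * (e p.2 : ℂ))},
      ∃ g h : Matrix (Fin m) (Fin m) (MvPolynomial (Fin n × Fin n) ℂ),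
        (∀ i j, (g i j).totalDegree ≤ 1) ∧ (∀ i j, (h i j).totalDegree ≤ 1) ∧
        IsUnit g.det ∧ IsUnit h.det ∧ Matrix.linSubstEntries γ B * h = g * B) :
    IsAffineDetRepr (perPoly (Fin n) ℂ) (B.map (MvPolynomial.rename (Prod.map ρ κ))) ∧
    ∀ γ' ∈ {γ : Matrix.GeneralLinearGroup (Fin n × Fin n) ℂ |
        ∃ d e : Fin n → ℂˣ,
          (∀ i, (∏ k, (d k) ^ (Λ i (Sum.inl (ρ.symm k)))) *
              (∏ l, (e l) ^ (Λ i (Sum.inr (κ.symm l)))) = 1) ∧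
          (γ : Matrix (Fin n × Fin n) (Fin n × Fin n) ℂ) =
            Matrix.diagonal (fun p => (d p.1 : ℂ) * (e p.2 : ℂ))},
      ∃ g h : Matrix (Fin m) (Fin m) (MvPolynomial (Fin n × Fin n) ℂ),
        (∀ i j, (g i j).totalDegree ≤ 1) ∧ (∀ i j, (h i j).totalDegree ≤ 1) ∧
        IsUnit g.det ∧ IsUnit h.det ∧
        Matrix.linSubstEntries γ' (B.map (MvPolynomial.rename (Prod.map ρ κ))) * h =
          g * B.map (MvPolynomial.rename (Prod.map ρ κ)) := by
  refine ⟨⟨fun i j => ?_, ?_⟩, ?_⟩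
  · rw [Matrix.map_apply]
    exact (totalDegree_rename_le _ _).trans (hB.1 i j)
  · rw [← AlgHom.mapMatrix_apply, ← AlgHom.map_det, hB.2, rename_prodMap_perPoly]
  · rintro γ' ⟨d', e', hrel', hγ'⟩
    -- the transported element `γ = diag (d'_{ρ k} e'_{κ l})` of `T_Λ`
    have hrel : ∀ i, (∏ k, (d' (ρ k)) ^ (Λ i (Sum.inl k))) *
        (∏ l, (e' (κ l)) ^ (Λ i (Sum.inr l))) = 1 := by
      intro i
      rw [← hrel' i]
      congr 1
      · exact Fintype.prod_equiv ρ _ _ fun k => by rw [Equiv.symm_apply_apply]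
      · exact Fintype.prod_equiv κ _ _ fun l => by rw [Equiv.symm_apply_apply]
    let γ : GL (Fin n × Fin n) ℂ :=
      Grenet.diagUnit (fun p : Fin n × Fin n => (d' (ρ p.1) : ℂ) * (e' (κ p.2) : ℂ))
        (fun p => mul_ne_zero (d' (ρ p.1)).ne_zero (e' (κ p.2)).ne_zero)
    have hγ : (γ : Matrix (Fin n × Fin n) (Fin n × Fin n) ℂ) =
        Matrix.diagonal (fun p : Fin n × Fin n => (d' (ρ p.1) : ℂ) * (e' (κ p.2) : ℂ)) := rfl
    obtain ⟨g, h, hg, hh, hgu, hhu, heq⟩ := hL γ ⟨fun k => d' (ρ k), fun l => e' (κ l), hrel, hγ⟩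
    -- push the lift equation through `rename`
    set R : MvPolynomial (Fin n × Fin n) ℂ →ₐ[ℂ] MvPolynomial (Fin n × Fin n) ℂ :=
      MvPolynomial.rename (Prod.map ρ κ) with hR
    refine ⟨g.map R, h.map R, fun i j => ?_, fun i j => ?_, ?_, ?_, ?_⟩
    · rw [Matrix.map_apply]; exact (totalDegree_rename_le _ _).trans (hg i j)
    · rw [Matrix.map_apply]; exact (totalDegree_rename_le _ _).trans (hh i j)
    · rw [← AlgHom.mapMatrix_apply, ← AlgHom.map_det]; exact hgu.map _
    · rw [← AlgHom.mapMatrix_apply, ← AlgHom.map_det]; exact hhu.map _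
    · rw [linSubstEntries_map_rename_diagonal (Prod.map ρ κ)
          (fun p : Fin n × Fin n => (d' (ρ p.1) : ℂ) * (e' (κ p.2) : ℂ))
          (fun q : Fin n × Fin n => (d' q.1 : ℂ) * (e' q.2 : ℂ)) (fun p => rfl) γ γ' hγ hγ' B]
      have := congrArg (fun M : Matrix (Fin m) (Fin m) (MvPolynomial (Fin n × Fin n) ℂ) => M.map R) heq
      simpa only [Matrix.map_mul] using this

/-! ### §2 Degree-one lifts descend through the sacrifice substitution -/

/-- The floor's `stub_substLifts`, one gauge degree up: every generator `diag(d'_k e'_l)` of the full two-sided torus of the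
free `n' × n'` block has DEGREE-`1` unimodular lifts for the substituted matrix `B.map (aeval g)`, given degree-`1` lifts of the
generators of `T_Λ` for `B` and the extension property of the free torus across the sacrificed diagonal pairs (`aeval g` is a
ring map preserving total degree `≤ 1` and units). [folklore] -/
theorem gaugeLifts_one_subst (n' s r m : ℕ) (Λ : Fin r → (Fin (n' + s) ⊕ Fin (n' + s)) → ℤ)
    (B : Matrix (Fin m) (Fin m) (MvPolynomial (Fin (n' + s) × Fin (n' + s)) ℂ))
    (g : Fin (n' + s) × Fin (n' + s) → MvPolynomial (Fin n' × Fin n') ℂ)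
    (hg₁ : ∀ k l, g (Fin.castAdd s k, Fin.castAdd s l) = X (k, l))
    (hg₂ : ∀ k j, g (Fin.castAdd s k, Fin.natAdd n' j) = 0)
    (hg₃ : ∀ j l, g (Fin.natAdd n' j, Fin.castAdd s l) = 0)
    (hg₄ : ∀ j j', g (Fin.natAdd n' j, Fin.natAdd n' j') = if j = j' then 1 else 0)
    (hext : ∀ d' e' : Fin n' → ℂ, (∀ k, d' k ≠ 0) → (∀ l, e' l ≠ 0) →
      ∃ d e : Fin (n' + s) → ℂˣ,
        (∀ i, (∏ k, (d k) ^ (Λ i (Sum.inl k))) * (∏ l, (e l) ^ (Λ i (Sum.inr l))) = 1) ∧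
        (∀ k l, (d (Fin.castAdd s k) : ℂ) * (e (Fin.castAdd s l) : ℂ) = d' k * e' l) ∧
        (∀ j, (d (Fin.natAdd n' j) : ℂ) * (e (Fin.natAdd n' j) : ℂ) = 1))
    (hL : ∀ γ ∈ {γ : Matrix.GeneralLinearGroup (Fin (n' + s) × Fin (n' + s)) ℂ |
        ∃ d e : Fin (n' + s) → ℂˣ,
          (∀ i, (∏ k, (d k) ^ (Λ i (Sum.inl k))) * (∏ l, (e l) ^ (Λ i (Sum.inr l))) = 1) ∧
          (γ : Matrix (Fin (n' + s) × Fin (n' + s)) (Fin (n' + s) × Fin (n' + s)) ℂ) =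
            Matrix.diagonal (fun p => (d p.1 : ℂ) * (e p.2 : ℂ))},
      ∃ g₁ h₁ : Matrix (Fin m) (Fin m) (MvPolynomial (Fin (n' + s) × Fin (n' + s)) ℂ),
        (∀ i j, (g₁ i j).totalDegree ≤ 1) ∧ (∀ i j, (h₁ i j).totalDegree ≤ 1) ∧
        IsUnit g₁.det ∧ IsUnit h₁.det ∧ Matrix.linSubstEntries γ B * h₁ = g₁ * B)
    (hgdeg : ∀ p, (g p).totalDegree ≤ 1) :
    ∀ γ' ∈ {γ' : GL (Fin n' × Fin n') ℂ | ∃ d' e' : Fin n' → ℂ,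
        (γ' : Matrix (Fin n' × Fin n') (Fin n' × Fin n') ℂ) = Matrix.diagonal (fun p => d' p.1 * e' p.2)},
      ∃ g₂ h₂ : Matrix (Fin m) (Fin m) (MvPolynomial (Fin n' × Fin n') ℂ),
        (∀ i j, (g₂ i j).totalDegree ≤ 1) ∧ (∀ i j, (h₂ i j).totalDegree ≤ 1) ∧
        IsUnit g₂.det ∧ IsUnit h₂.det ∧
        Matrix.linSubstEntries γ' (B.map (MvPolynomial.aeval g)) * h₂ = g₂ * B.map (MvPolynomial.aeval g) := by
  rintro γ' ⟨d', e', hγ'⟩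
  -- invertibility of `γ'` forces `d'_k e'_l ≠ 0`
  have hdet : (γ' : Matrix (Fin n' × Fin n') (Fin n' × Fin n') ℂ).det ≠ 0 := by
    rw [← Matrix.GeneralLinearGroup.val_det_apply]
    exact Units.ne_zero _
  rw [hγ', Matrix.det_diagonal] at hdet
  have hne : ∀ k l : Fin n', d' k * e' l ≠ 0 := fun k l =>
    Finset.prod_ne_zero_iff.1 hdet (k, l) (Finset.mem_univ _)
  -- extend `(d', e')` across the sacrificed pairs
  obtain ⟨d, e, hrel, hfree, hsac⟩ := hext d' e' (fun k => left_ne_zero_of_mul (hne k k))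
    (fun l => right_ne_zero_of_mul (hne l l))
  -- the torus element `γ = diag(d_k e_l)` (a generator of `T_Λ`) and its degree-one lifts for `B`
  let γ : GL (Fin (n' + s) × Fin (n' + s)) ℂ :=
    Grenet.diagUnit (fun p : Fin (n' + s) × Fin (n' + s) => (d p.1 : ℂ) * (e p.2 : ℂ))
      (fun p => mul_ne_zero (d p.1).ne_zero (e p.2).ne_zero)
  have hγ : (γ : Matrix (Fin (n' + s) × Fin (n' + s)) (Fin (n' + s) × Fin (n' + s)) ℂ) =
      Matrix.diagonal (fun p => (d p.1 : ℂ) * (e p.2 : ℂ)) := rfl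
  obtain ⟨g₁, h₁, hg₁deg, hh₁deg, hg₁u, hh₁u, hlift⟩ := hL γ ⟨d, e, hrel, hγ⟩
  -- KEY: `aeval g` intertwines the substitution by `γ` with the substitution by `γ'`
  have key : (aeval g).comp (linSubst (Fin (n' + s) × Fin (n' + s)) ℂ
        (γ : Matrix (Fin (n' + s) × Fin (n' + s)) (Fin (n' + s) × Fin (n' + s)) ℂ)) =
      (linSubst (Fin n' × Fin n') ℂ (γ' : Matrix (Fin n' × Fin n') (Fin n' × Fin n') ℂ)).comp
        (aeval g) := by
    apply MvPolynomial.algHom_ext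
    rintro ⟨p₁, p₂⟩
    rw [AlgHom.comp_apply, AlgHom.comp_apply, hγ, hγ', Grenet.linSubst_diagonal_X, map_smul, aeval_X]
    dsimp only
    induction p₁ using Fin.addCases with
    | left k =>
      induction p₂ using Fin.addCases with
      | left l =>
        rw [hg₁, hfree, Grenet.linSubst_diagonal_X]
      | right j =>
        rw [hg₂, smul_zero, map_zero]
    | right j =>
      induction p₂ using Fin.addCases with
      | left l =>
        rw [hg₃, smul_zero, map_zero]
      | right j' =>
        rw [hg₄]
        split_ifs with hjj
        · subst hjj
          rw [hsac, one_smul, map_one]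
        · rw [smul_zero, map_zero]
  set A : MvPolynomial (Fin (n' + s) × Fin (n' + s)) ℂ →ₐ[ℂ] MvPolynomial (Fin n' × Fin n') ℂ := aeval g with hA
  refine ⟨g₁.map A, h₁.map A, fun i j => ?_, fun i j => ?_, ?_, ?_, ?_⟩
  · rw [Matrix.map_apply]; exact totalDegree_aeval_le_one g hgdeg _ (hg₁deg i j)
  · rw [Matrix.map_apply]; exact totalDegree_aeval_le_one g hgdeg _ (hh₁deg i j)
  · rw [← AlgHom.mapMatrix_apply, ← AlgHom.map_det]; exact hg₁u.map _
  · rw [← AlgHom.mapMatrix_apply, ← AlgHom.map_det]; exact hh₁u.map _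
  · have hsub : Matrix.linSubstEntries γ' (B.map A) = (Matrix.linSubstEntries γ B).map A := by
      simp only [Matrix.linSubstEntries, Matrix.map_map]
      congr 1
      funext f
      exact (AlgHom.congr_fun key f).symm
    rw [hsub, ← Matrix.map_mul, hlift, Matrix.map_mul]

/-! ### §3 The stub -/

/-- **Stub `stub_gaugeReduction` of the line `affine_gauge`** (statement = the line's `GaugeTorusBound 1 → AffineGaugeCovering`
with the `Lines/GaugeLadder.lean` vocabulary unfolded): the floor's pair-sacrifice reduction carries degree-`1` unimodular gauge
lifts — the `r = 0` engine at gauge degree `1` implies the rung. [cite: LandsbergRessayre2017, Thm. 2.8] -/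
theorem stub_gaugeReduction :
    (∀ n : ℕ, 3 ≤ n → ∀ (m : ℕ) (B : Matrix (Fin m) (Fin m) (MvPolynomial (Fin n × Fin n) ℂ)),
      IsAffineDetRepr (perPoly (Fin n) ℂ) B →
      (∀ γ ∈ {γ : GL (Fin n × Fin n) ℂ | ∃ d e : Fin n → ℂ,
          (γ : Matrix (Fin n × Fin n) (Fin n × Fin n) ℂ) = Matrix.diagonal (fun p => d p.1 * e p.2)},
        ∃ g h : Matrix (Fin m) (Fin m) (MvPolynomial (Fin n × Fin n) ℂ),
          (∀ i j, (g i j).totalDegree ≤ 1) ∧ (∀ i j, (h i j).totalDegree ≤ 1) ∧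
          IsUnit g.det ∧ IsUnit h.det ∧
          Matrix.linSubstEntries γ B * h = g * B) →
      2 ^ n - 1 ≤ m) →
    ∀ n : ℕ, 3 ≤ n → ∀ (m r : ℕ) (Λ : Fin r → (Fin n ⊕ Fin n) → ℤ)
      (B : Matrix (Fin m) (Fin m) (MvPolynomial (Fin n × Fin n) ℂ)),
      (∀ i, (∑ k, Λ i (Sum.inl k)) = 0 ∧ (∑ l, Λ i (Sum.inr l)) = 0) →
      IsAffineDetRepr (perPoly (Fin n) ℂ) B →
      (∀ γ ∈ {γ : Matrix.GeneralLinearGroup (Fin n × Fin n) ℂ |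
          ∃ d e : Fin n → ℂˣ, (∀ i, (∏ k, (d k) ^ (Λ i (Sum.inl k))) * (∏ l, (e l) ^ (Λ i (Sum.inr l))) = 1) ∧
            (γ : Matrix (Fin n × Fin n) (Fin n × Fin n) ℂ) = Matrix.diagonal (fun p => (d p.1 : ℂ) * (e p.2 : ℂ))},
        ∃ g h : Matrix (Fin m) (Fin m) (MvPolynomial (Fin n × Fin n) ℂ),
          (∀ i j, (g i j).totalDegree ≤ 1) ∧ (∀ i j, (h i j).totalDegree ≤ 1) ∧
          IsUnit g.det ∧ IsUnit h.det ∧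
          Matrix.linSubstEntries γ B * h = g * B) →
      Nat.choose n (n / 2) ≤ m * 2 ^ r := by
  intro hGTB n hn m r Λ B hΛ hB hL
  classical
  -- (0) the degree bound `n ≤ m`
  have hmn : n ≤ m := by
    have h1 := totalDegree_le_of_hasDetRepr_holds (k := ℂ) (σ := Fin n × Fin n) ⟨B, hB⟩
    have h2 : (perPoly (Fin n) ℂ).totalDegree = n := by
      rw [totalDegree_perPoly_holds (n := Fin n) (k := ℂ), Fintype.card_fin]
    rw [h2] at h1
    exact h1
  -- (1) the matching
  obtain ⟨s, ι, κ, hsr, hcase⟩ := stub_indepMatching n r Λ (fun i => (hΛ i).1)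
  by_cases hdeg : n ≤ s + 2
  · calc n.choose (n / 2) ≤ 2 ^ (n - 1) := choose_middle_le_two_pow_pred n (by omega)
      _ = 2 * 2 ^ (n - 2) := by rw [← pow_succ']; congr 1; omega
      _ ≤ n * 2 ^ (n - 2) := Nat.mul_le_mul_right _ (by omega)
      _ ≤ m * 2 ^ r := Nat.mul_le_mul hmn (Nat.pow_le_pow_right (by norm_num) (by omega))
  rcases hcase with h | ⟨N, hN, hrow, hcol⟩
  · exact absurd h hdeg
  obtain ⟨n', rfl⟩ : ∃ n', n = n' + s := ⟨n - s, by omega⟩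
  have hn' : 3 ≤ n' := by omega
  -- (2) relabel: sacrificed pairs to the last `s` diagonal positions
  obtain ⟨ρ, hρ⟩ := exists_perm_extend_embedding ι (Fin.natAddEmb n')
  obtain ⟨κ₀, hκ₀⟩ := exists_perm_extend_embedding κ (Fin.natAddEmb n')
  have hρ' : ∀ j, ρ.symm (Fin.natAdd n' j) = ι j := fun j => by
    rw [Equiv.symm_apply_eq]; exact (hρ j).symm
  have hκ₀' : ∀ j, κ₀.symm (Fin.natAdd n' j) = κ j := fun j => by
    rw [Equiv.symm_apply_eq]; exact (hκ₀ j).symm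
  set Λ' : Fin r → (Fin (n' + s) ⊕ Fin (n' + s)) → ℤ := fun i =>
    Sum.elim (fun k => Λ i (Sum.inl (ρ.symm k))) (fun l => Λ i (Sum.inr (κ₀.symm l))) with hΛ'
  set B₁ : Matrix (Fin m) (Fin m) (MvPolynomial (Fin (n' + s) × Fin (n' + s)) ℂ) :=
    B.map (MvPolynomial.rename (Prod.map ρ κ₀)) with hB₁def
  obtain ⟨hB₁, hL₁⟩ := gaugeLifts_one_relabel (n' + s) r m Λ B ρ κ₀ hB hL
  have hL₁' : ∀ γ ∈ {γ : Matrix.GeneralLinearGroup (Fin (n' + s) × Fin (n' + s)) ℂ |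
        ∃ d e : Fin (n' + s) → ℂˣ,
          (∀ i, (∏ k, (d k) ^ (Λ' i (Sum.inl k))) * (∏ l, (e l) ^ (Λ' i (Sum.inr l))) = 1) ∧
          (γ : Matrix (Fin (n' + s) × Fin (n' + s)) (Fin (n' + s) × Fin (n' + s)) ℂ) =
            Matrix.diagonal (fun p => (d p.1 : ℂ) * (e p.2 : ℂ))},
      ∃ g₁ h₁ : Matrix (Fin m) (Fin m) (MvPolynomial (Fin (n' + s) × Fin (n' + s)) ℂ),
        (∀ i j, (g₁ i j).totalDegree ≤ 1) ∧ (∀ i j, (h₁ i j).totalDegree ≤ 1) ∧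
        IsUnit g₁.det ∧ IsUnit h₁.det ∧ Matrix.linSubstEntries γ B₁ * h₁ = g₁ * B₁ := by
    rintro γ ⟨d, e, hrel, hγ⟩
    exact hL₁ γ ⟨d, e, fun i => by simpa only [hΛ', Sum.elim_inl, Sum.elim_inr] using hrel i, hγ⟩
  -- (3) the integer relations, relabelled
  have hrow' : ∀ k : Fin n', ∃ a : Fin s → ℤ, ∀ i,
      (N : ℤ) * Λ' i (Sum.inl (Fin.castAdd s k)) =
        ∑ j, a j * (Λ' i (Sum.inl (Fin.natAdd n' j)) - Λ' i (Sum.inr (Fin.natAdd n' j))) := by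
    intro k
    obtain ⟨a, ha⟩ := hrow (ρ.symm (Fin.castAdd s k))
    refine ⟨a, fun i => ?_⟩
    simp only [hΛ', Sum.elim_inl, Sum.elim_inr, hρ', hκ₀']
    exact ha i
  have hcol' : ∀ l : Fin n', ∃ a : Fin s → ℤ, ∀ i,
      (N : ℤ) * Λ' i (Sum.inr (Fin.castAdd s l)) =
        ∑ j, a j * (Λ' i (Sum.inl (Fin.natAdd n' j)) - Λ' i (Sum.inr (Fin.natAdd n' j))) := by
    intro l
    obtain ⟨a, ha⟩ := hcol (κ₀.symm (Fin.castAdd s l))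
    refine ⟨a, fun i => ?_⟩
    simp only [hΛ', Sum.elim_inl, Sum.elim_inr, hρ', hκ₀']
    exact ha i
  -- (4) the extension property of the free torus (roots of `N`-th powers exist in `ℂ`)
  have hext : ∀ d' e' : Fin n' → ℂ, (∀ k, d' k ≠ 0) → (∀ l, e' l ≠ 0) →
      ∃ d e : Fin (n' + s) → ℂˣ,
        (∀ i, (∏ k, (d k) ^ (Λ' i (Sum.inl k))) * (∏ l, (e l) ^ (Λ' i (Sum.inr l))) = 1) ∧
        (∀ k l, (d (Fin.castAdd s k) : ℂ) * (e (Fin.castAdd s l) : ℂ) = d' k * e' l) ∧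
        (∀ j, (d (Fin.natAdd n' j) : ℂ) * (e (Fin.natAdd n' j) : ℂ) = 1) := by
    intro d' e' hd' he'
    choose dr hdr using fun k => IsAlgClosed.exists_pow_nat_eq (d' k) hN
    choose er her using fun l => IsAlgClosed.exists_pow_nat_eq (e' l) hN
    have hdr0 : ∀ k, dr k ≠ 0 := fun k h0 => hd' k (by rw [← hdr k, h0, zero_pow hN.ne'])
    have her0 : ∀ l, er l ≠ 0 := fun l h0 => he' l (by rw [← her l, h0, zero_pow hN.ne'])
    obtain ⟨d, e, hrel, hd, he, hde⟩ := stub_torusExtension n' s r Λ' N hN hrow' hcol'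
      (fun k => Units.mk0 (dr k) (hdr0 k)) (fun l => Units.mk0 (er l) (her0 l))
    refine ⟨d, e, hrel, fun k l => ?_, fun j => ?_⟩
    · rw [hd k, he l, Units.val_pow_eq_pow_val, Units.val_pow_eq_pow_val, Units.val_mk0,
        Units.val_mk0, hdr k, her l]
    · rw [← Units.val_mul, hde j, Units.val_one]
  -- (5) the substitution
  let g : Fin (n' + s) × Fin (n' + s) → MvPolynomial (Fin n' × Fin n') ℂ := fun p =>
    Fin.addCases (motive := fun _ => MvPolynomial (Fin n' × Fin n') ℂ)
      (fun k => Fin.addCases (motive := fun _ => MvPolynomial (Fin n' × Fin n') ℂ)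
        (fun l => X (k, l)) (fun _ => 0) p.2)
      (fun j => Fin.addCases (motive := fun _ => MvPolynomial (Fin n' × Fin n') ℂ)
        (fun _ => 0) (fun j' => if j = j' then 1 else 0) p.2)
      p.1
  have hg₁ : ∀ k l, g (Fin.castAdd s k, Fin.castAdd s l) = X (k, l) := fun k l => by
    simp [g]
  have hg₂ : ∀ k j, g (Fin.castAdd s k, Fin.natAdd n' j) = 0 := fun k j => by
    simp [g]
  have hg₃ : ∀ j l, g (Fin.natAdd n' j, Fin.castAdd s l) = 0 := fun j l => by
    simp [g]
  have hg₄ : ∀ j j', g (Fin.natAdd n' j, Fin.natAdd n' j') = if j = j' then 1 else 0 :=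
    fun j j' => by simp [g]
  have hgdeg : ∀ p, (g p).totalDegree ≤ 1 := by
    rintro ⟨a, b⟩
    induction a using Fin.addCases <;> induction b using Fin.addCases
    · rw [hg₁]; exact (totalDegree_X _).le
    · rw [hg₂]; simp
    · rw [hg₃]; simp
    · rw [hg₄]; split_ifs <;> simp
  set B₂ : Matrix (Fin m) (Fin m) (MvPolynomial (Fin n' × Fin n') ℂ) :=
    B₁.map (MvPolynomial.aeval g) with hB₂def
  have haff₂ : ∀ i j, (B₂ i j).totalDegree ≤ 1 := fun i j => by
    rw [hB₂def, Matrix.map_apply]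
    exact totalDegree_aeval_le_one g hgdeg _ (hB₁.1 i j)
  have hdet₂ : B₂.det = perPoly (Fin n') ℂ := by
    rw [hB₂def, ← AlgHom.mapMatrix_apply, ← AlgHom.map_det, hB₁.2,
      stub_substPer n' s g hg₁ hg₂ hg₃ hg₄]
  have hlifts := gaugeLifts_one_subst n' s r m Λ' B₁ g hg₁ hg₂ hg₃ hg₄ hext hL₁' hgdeg
  -- (6) the engine at gauge degree one (HYPOTHESIS) and the arithmetic
  have hbound : 2 ^ n' - 1 ≤ m := hGTB n' hn' m B₂ ⟨haff₂, hdet₂⟩ hlifts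
  calc (n' + s).choose ((n' + s) / 2) ≤ 2 ^ (n' + s - 1) :=
        choose_middle_le_two_pow_pred _ (by omega)
    _ = 2 ^ (n' - 1) * 2 ^ s := by rw [← pow_add]; congr 1; omega
    _ ≤ (2 ^ n' - 1) * 2 ^ s := by
        apply Nat.mul_le_mul_right
        have : 2 ^ n' = 2 * 2 ^ (n' - 1) := by rw [← pow_succ']; congr 1; omega
        omega
    _ ≤ m * 2 ^ r := Nat.mul_le_mul hbound (Nat.pow_le_pow_right (by norm_num) hsr)

end

end Summit.ValiantsHypothesis.ValiantsHypothesis.Theorems.FreeSubtorusOrbitDimensionBound.AffineGauge
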